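import Mathlib
import HarnessLib

/-!
# Support matching for the Taylor pieces along an adapted frame (exactness)

(Line `janus-bands`, crux `ArrangementNormalForm`, stub `stub_separateHigh_hH`, part `AllHHExact` of
the dimension-generic wall-invariant termwise-split lemma, base dimension `b + 1 ≥ 4` with fibres;
namespace `SepAll`.)
Pure polynomial algebra. In the frame coordinates `s` of a nested sector at a point of the pole
hyperplane, the numerator of a terminal piece is `G = ∑_{i<N} λ^i K_i` with the LINEAR pole
coordinate `λ = ∑_l a_l X_l`, `a_l = 0` below the pole level `j⋆`, and Taylor coefficients `K_i`
NOT INVOLVING the variable `X_{l₀}` of the frame vector on the vertical line (`a_{l₀} ≠ 0`); the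
Taylor pieces are the terms `λ^i K_i`. THE MATCHING THEOREM (`exact_support`, registered as
`separateAllHH_exact`): every monomial `s^γ` of a piece admits a monomial `s^{γ'}` OF THE TOTAL `G`
with the same exponents below `j⋆` and the same total degree — hence the same exponents in the
loaded blown-up variables. Proof: among the pairs `(i', β')`, `β'` a monomial of `K_{i'}` in the
class of `γ`, take `i' = m` maximal; the coefficient of `X_{l₀}^m s^{β'}` in `G` is
`a_{l₀}^m · [s^{β'}] K_m ≠ 0`, the other pieces contributing nothing there (`X_{l₀}`-degree `< m`
for `i' < m`, maximality for `i' > m`). Elementary support calculus of `λ^i`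
(`support_lamP_pow`, `coeff_lamP_pow_single`, `coeff_extremal`).
-/

noncomputable section

open Finset MvPolynomial

namespace Summit.KontsevichZagierPeriods.ArrangementNormalForm.JanusBands

namespace SepAll

variable {D : ℕ}

/-- The linear pole coordinate in frame coordinates. -/
abbrev lamP (a : Fin D → ℝ) : MvPolynomial (Fin D) ℝ := ∑ l, C (a l) * X l

/-! ### Finitely supported exponents -/

/-- An exponent whose degree sits at one variable is a pure power. -/
theorem eq_single_of_degree_eq {d : Fin D →₀ ℕ} {l₀ : Fin D} (h : d.degree = d l₀) :
    d = Finsupp.single l₀ (d l₀) := by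
  classical
  ext i
  by_cases hi : i = l₀
  · subst hi; simp
  · rw [Finsupp.single_eq_of_ne hi]
    rw [Finsupp.degree_eq_sum, ← Finset.add_sum_erase _ _ (Finset.mem_univ l₀)] at h
    have h1 : ∑ j ∈ univ.erase l₀, d j = 0 := by omega
    have h2 : d i ≤ ∑ j ∈ univ.erase l₀, d j :=
      Finset.single_le_sum (f := fun j => d j) (fun _ _ => Nat.zero_le _)
        (Finset.mem_erase.2 ⟨hi, Finset.mem_univ i⟩)
    omega

/-! ### The support of the powers of the pole coordinate -/

/-- Coefficients of the pole coordinate. -/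
theorem coeff_lamP_single (a : Fin D → ℝ) (l : Fin D) :
    coeff (Finsupp.single l 1) (lamP a) = a l := by
  classical
  rw [lamP, coeff_sum]
  simp_rw [coeff_C_mul, coeff_X]
  rw [sum_eq_single l]
  · simp
  · intro l' _ hne
    rw [if_neg, mul_zero]
    intro h
    exact hne (Finsupp.single_left_injective one_ne_zero h)
  · intro h; exact absurd (mem_univ l) h

/-- The support of the pole coordinate consists of first powers of variables with non-zero slope. -/
theorem support_lamP {a : Fin D → ℝ} {d : Fin D →₀ ℕ} (hd : d ∈ (lamP a).support) :
    ∃ l, a l ≠ 0 ∧ d = Finsupp.single l 1 := by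
  classical
  rw [mem_support_iff, lamP, coeff_sum] at hd
  obtain ⟨l, -, hl⟩ := exists_ne_zero_of_sum_ne_zero hd
  rw [coeff_C_mul, coeff_X] at hl
  by_cases h : Finsupp.single l 1 = d
  · refine ⟨l, ?_, h.symm⟩
    rw [if_pos h, mul_one] at hl
    exact hl
  · rw [if_neg h, mul_zero] at hl
    exact absurd rfl hl

/-- The pole coordinate is homogeneous of degree one. -/
theorem isHomogeneous_lamP (a : Fin D → ℝ) : (lamP a).IsHomogeneous 1 :=
  IsHomogeneous.sum _ _ _ fun _ _ => isHomogeneous_C_mul_X _ _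

/-- **The support of `λ^i`:** degree `i`, and no variable with vanishing slope. -/
theorem support_lamP_pow (a : Fin D → ℝ) (i : ℕ) {d : Fin D →₀ ℕ} (hd : d ∈ (lamP a ^ i).support) :
    d.degree = i ∧ ∀ l, a l = 0 → d l = 0 := by
  classical
  refine ⟨?_, ?_⟩
  · have h := (isHomogeneous_lamP a).pow i
    rw [one_mul] at h
    have h' := h (mem_support_iff.1 hd)
    rw [Finsupp.degree_eq_weight_one]
    exact h'
  · induction i generalizing d with
    | zero =>
      intro l _
      rw [pow_zero] at hd
      have : d = 0 := by
        by_contra hne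
        rw [mem_support_iff, coeff_one, if_neg (Ne.symm hne)] at hd
        exact hd rfl
      simp [this]
    | succ i ih =>
      intro l hl
      rw [pow_succ] at hd
      obtain ⟨x1, hx1, x2, hx2, rfl⟩ := Finset.mem_add.1 (support_mul _ _ hd)
      obtain ⟨l', hl', rfl⟩ := support_lamP hx2
      have hll' : l ≠ l' := fun h => hl' (h ▸ hl)
      rw [Finsupp.add_apply, ih hx1 l hl, Finsupp.single_eq_of_ne hll', add_zero]

/-- **The coefficient of `λ^m` at the pure power `X_{l₀}^m` is `a_{l₀}^m`.** -/
theorem coeff_lamP_pow_single (a : Fin D → ℝ) (l₀ : Fin D) (m : ℕ) :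
    coeff (Finsupp.single l₀ m) (lamP a ^ m) = a l₀ ^ m := by
  classical
  induction m with
  | zero => simp
  | succ m ih =>
    rw [pow_succ, coeff_mul, sum_eq_single (Finsupp.single l₀ m, Finsupp.single l₀ 1)]
    · rw [ih, coeff_lamP_single, pow_succ]
    · rintro ⟨x1, x2⟩ hx hne
      rw [Finset.HasAntidiagonal.mem_antidiagonal] at hx
      by_contra hprod
      obtain ⟨h1, h2⟩ := mul_ne_zero_iff.1 hprod
      obtain ⟨l, -, rfl⟩ := support_lamP (mem_support_iff.2 h2)
      have hd := (support_lamP_pow a m (mem_support_iff.2 h1)).1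
      -- `l = l₀`
      have hl : l = l₀ := by
        by_contra hl
        have := congrArg (fun f : Fin D →₀ ℕ => f l) hx
        simp [Finsupp.single_eq_of_ne hl] at this
      subst hl
      have hx1 : x1 = Finsupp.single l m := by
        have e : Finsupp.single l (m + 1) = Finsupp.single l m + Finsupp.single l 1 := by
          rw [Finsupp.single_add]
        rw [e] at hx
        exact add_right_cancel hx
      exact hne (Prod.ext hx1 rfl)
    · intro h
      exact (h (Finset.HasAntidiagonal.mem_antidiagonal.2 (Finsupp.single_add l₀ m 1).symm)).elim

/-- **The coefficient of `λ^m · K` at the extremal monomial `X_{l₀}^m s^β`** (for `K` free of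
`X_{l₀}`) is `a_{l₀}^m · [s^β] K`. -/
theorem coeff_extremal (a : Fin D → ℝ) (l₀ : Fin D) (m : ℕ) {K : MvPolynomial (Fin D) ℝ}
    (hK : ∀ d ∈ K.support, d l₀ = 0) {β : Fin D →₀ ℕ} (hβ : β l₀ = 0) :
    coeff (Finsupp.single l₀ m + β) (lamP a ^ m * K) = a l₀ ^ m * coeff β K := by
  classical
  rw [coeff_mul, sum_eq_single (Finsupp.single l₀ m, β)]
  · rw [coeff_lamP_pow_single]
  · rintro ⟨x1, x2⟩ hx hne
    rw [Finset.HasAntidiagonal.mem_antidiagonal] at hx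
    by_contra hprod
    obtain ⟨h1, h2⟩ := mul_ne_zero_iff.1 hprod
    have hx2 : x2 l₀ = 0 := hK x2 (mem_support_iff.2 h2)
    have hd := (support_lamP_pow a m (mem_support_iff.2 h1)).1
    have hx1l : x1 l₀ = m := by
      have := congrArg (fun f : Fin D →₀ ℕ => f l₀) hx
      simp only [Finsupp.add_apply, hx2, hβ, Finsupp.single_eq_same] at this
      omega
    have hx1 : x1 = Finsupp.single l₀ m := by
      have := eq_single_of_degree_eq (d := x1) (l₀ := l₀) (by rw [hd, hx1l])
      rwa [hx1l] at this
    subst hx1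
    have hx2' : x2 = β := add_left_cancel hx
    exact hne (Prod.ext rfl hx2')
  · intro h
    exact (h (Finset.HasAntidiagonal.mem_antidiagonal.2 rfl)).elim

/-- Monomials of `λ^i · K`: decomposition and the bound on the `X_{l₀}`-exponent. -/
theorem support_piece (a : Fin D → ℝ) (i : ℕ) {K : MvPolynomial (Fin D) ℝ} {l₀ : Fin D}
    (hK : ∀ d ∈ K.support, d l₀ = 0) {x : Fin D →₀ ℕ} (hx : x ∈ (lamP a ^ i * K).support) :
    ∃ x1 x2, x2 ∈ K.support ∧ x = x1 + x2 ∧ x1.degree = i ∧ (∀ l, a l = 0 → x1 l = 0) ∧ x l₀ ≤ i := by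
  classical
  obtain ⟨x1, hx1, x2, hx2, rfl⟩ := Finset.mem_add.1 (support_mul _ _ hx)
  obtain ⟨hd, hz⟩ := support_lamP_pow a i hx1
  refine ⟨x1, x2, hx2, rfl, hd, hz, ?_⟩
  rw [Finsupp.add_apply, hK x2 hx2, add_zero, ← hd]
  exact Finsupp.le_degree l₀ x1

/-! ### The matching theorem -/

/-- **Support matching (exactness of the loaded grading).** See the module docstring. -/
theorem exact_support (jstar l₀ : Fin D) (a : Fin D → ℝ) (ha : ∀ l, l < jstar → a l = 0)
    (hal₀ : a l₀ ≠ 0) (N : ℕ) (K : ℕ → MvPolynomial (Fin D) ℝ)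
    (hK : ∀ i, ∀ d ∈ (K i).support, d l₀ = 0) {i : ℕ} (hi : i < N) {γ : Fin D →₀ ℕ}
    (hγ : γ ∈ (lamP a ^ i * K i).support) :
    ∃ γ' ∈ (∑ i' ∈ range N, lamP a ^ i' * K i').support,
      (∀ l, l < jstar → γ' l = γ l) ∧ γ'.degree = γ.degree := by
  classical
  obtain ⟨x1, β, hβ, rfl, hdeg, hzero, -⟩ := support_piece a i (hK i) hγ
  -- the class of `γ`: exponents below `jstar` those of `β`, total degree `i + deg β`
  set Q : ℕ → Prop := fun i' => i' < N ∧ ∃ β' ∈ (K i').support,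
    (∀ l, l < jstar → β' l = β l) ∧ i' + β'.degree = i + β.degree with hQ
  have hQi : Q i := ⟨hi, β, hβ, fun l _ => rfl, rfl⟩
  set m := Nat.findGreatest Q N with hm
  have hmQ : Q m := Nat.findGreatest_spec hi.le hQi
  have him : i ≤ m := Nat.le_findGreatest hi.le hQi
  obtain ⟨hmN, β', hβ', hβ'low, hβ'deg⟩ := hmQ
  have hβ'l₀ : β' l₀ = 0 := hK m β' hβ'
  refine ⟨Finsupp.single l₀ m + β', ?_, fun l hl => ?_, ?_⟩
  · -- the extremal monomial survives in the total
    rw [mem_support_iff, coeff_sum, sum_eq_single m]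
    · rw [coeff_extremal a l₀ m (hK m) hβ'l₀]
      exact mul_ne_zero (pow_ne_zero _ hal₀) (mem_support_iff.1 hβ')
    · intro i' hi' hne
      by_contra hc
      have hmem : Finsupp.single l₀ m + β' ∈ (lamP a ^ i' * K i').support := mem_support_iff.2 hc
      obtain ⟨y1, y2, hy2, hy, hydeg, hyzero, hyl₀⟩ := support_piece a i' (hK i') hmem
      rcases lt_or_gt_of_ne hne with hlt | hgt
      · -- `i' < m`: the `X_{l₀}`-exponent is too small
        have : (Finsupp.single l₀ m + β') l₀ = m := by
          simp [hβ'l₀]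
        rw [this] at hyl₀
        exact absurd hyl₀ (not_le.2 hlt)
      · -- `i' > m`: contradicts maximality
        have hQ' : Q i' := by
          refine ⟨mem_range.1 hi', y2, hy2, fun l hl => ?_, ?_⟩
          · have e := congrArg (fun f : Fin D →₀ ℕ => f l) hy
            simp only [Finsupp.add_apply] at e
            have hl₀l : l ≠ l₀ := by
              intro h; subst h; exact hal₀ (ha l hl)
            rw [Finsupp.single_eq_of_ne hl₀l, hyzero l (ha l hl), zero_add, zero_add] at e
            rw [← e, hβ'low l hl]
          · have e := congrArg Finsupp.degree hy
            rw [map_add, map_add, Finsupp.degree_single, hydeg] at e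
            omega
        exact absurd hQ' (Nat.findGreatest_is_greatest hgt (mem_range.1 hi').le)
    · intro h
      exact absurd (mem_range.2 hmN) h
  · -- exponents below `jstar`
    have hl₀l : l ≠ l₀ := by
      intro h; subst h; exact hal₀ (ha l hl)
    simp only [Finsupp.add_apply, Finsupp.single_eq_of_ne hl₀l, zero_add]
    rw [hβ'low l hl, hzero l (ha l hl), zero_add]
  · -- total degree
    rw [map_add, map_add, Finsupp.degree_single, hdeg]
    omega

end SepAll

/-- **Support matching for the Taylor pieces along an adapted frame** (registered part of
`stub_separateHigh_hH`; literal form of `SepAll.exact_support`): with `λ = ∑_l C (a l) X_l`,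
`a l = 0` for `l < j⋆`, `a l₀ ≠ 0`, and coefficients `K i` free of the variable `X_{l₀}`, every
monomial of a piece `λ^i K_i` (`i < N`) has a monomial of the total `∑_{i<N} λ^i K_i` with the same
exponents below `j⋆` and the same total degree. -/
theorem separateAllHH_exact (D : ℕ) (jstar l₀ : Fin D) (a : Fin D → ℝ) (ha : ∀ l, l < jstar → a l = 0) (hal₀ : a l₀ ≠ 0) (N : ℕ) (K : ℕ → MvPolynomial (Fin D) ℝ) (hK : ∀ i, ∀ d ∈ (K i).support, d l₀ = 0) (i : ℕ) (hi : i < N) (γ : Fin D →₀ ℕ) (hγ : γ ∈ ((∑ l, MvPolynomial.C (a l) * MvPolynomial.X l) ^ i * K i).support) : ∃ γ' ∈ (∑ i' ∈ Finset.range N, (∑ l, MvPolynomial.C (a l) * MvPolynomial.X l) ^ i' * K i').support, (∀ l, l < jstar → γ' l = γ l) ∧ γ'.degree = γ.degree := by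
  exact SepAll.exact_support jstar l₀ a ha hal₀ N K hK hi hγ

end Summit.KontsevichZagierPeriods.ArrangementNormalForm.JanusBands
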